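import Summits.QuantumFields.YangMills.Theorems.PoincareLipschitzSobolevInversionPole
import HarnessLib

/-!
# Extension across the pole: weak derivatives and the Wente row (ROAD (W), brick W-INV, part 5)

Helper file (K2 lane of crux `stmt-QuantumFields-19936` `HistoryTailL` ∕ crux `stmt-QuantumFields-23533`
`BlockLipschitzL`, LINE 25 «CompactnessTransfer», ROAD (W) «the H-system energy gap at `3π` from the
sharp two-point Wente bound», brick W-INV).  YM₃ on the unit 3-torus is rung R3 of the ladder — NOT
`d = 4`, NOT infinite volume, NOT a mass gap, NOT the Clay problem; nothing here bears on those.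

`E² = EuclideanSpace ℝ (Fin 2)`, `e k = EuclideanSpace.single k 1`.  With the shrinking cut-offs and
the two vanishing lemmas of part 4:

* **`hasWeakFDerivOn_univ_of_compl_singleton`**: if `w` has the weak derivative `Gw` on `{c}ᶜ`,
  `w ∈ L²(B(c,r₀))` and `Σ_k (Gw e_k)² ∈ L¹(B(c,r₀))`, then `Gw` is the weak derivative of `w` on the
  whole plane (split a test function `φ = φ(1−χ_n) + φχ_n`; the first part is a test function off the
  pole; the three remainder integrals vanish as `n → ∞`);
* **`wenteRow_univ_of_compl_singleton`**: the row `−∫ Σ_k ∂_kη · Gu e_k = 2 ∫ η · J` for tests off the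
  pole extends to all compactly supported smooth `η` when `Σ_k (Gu e_k)² ∈ L¹(B(c,r₀))` and `J` is
  locally integrable.

References: H. Brezis, J.-M. Coron, Arch. Rational Mech. Anal. 89 (1985), Appendix p. 48; L. C. Evans,
*PDE* (2010), §5.2.1.
-/

noncomputable section

open MeasureTheory Set Filter Metric Module EuclideanGeometry TopologicalSpace
open scoped ENNReal Topology RealInnerProductSpace ContDiff

namespace Summit.QuantumFields.YangMills.Theorems.PoincareLipschitzSobolevInversion

open Literature.Analysis.FunctionSpaces

/-! ## §1 Weak derivatives extend across the pole -/

/-- **Removable pole for weak derivatives in the plane**: if `w` has the weak derivative `Gw` on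
`{c}ᶜ`, `w ∈ L²(B(c, r₀))` and `Σ_k (Gw e_k)² ∈ L¹(B(c, r₀))`, then `Gw` is the weak derivative of `w`
on the whole plane (points have zero `W^{1,2}`-capacity in dimension two). [cite: BrezisCoron1985, Appendix p. 48 (inversion step)] -/
theorem hasWeakFDerivOn_univ_of_compl_singleton {c : EuclideanSpace ℝ (Fin 2)} {w : EuclideanSpace ℝ (Fin 2) → ℝ}
    {Gw : EuclideanSpace ℝ (Fin 2) → EuclideanSpace ℝ (Fin 2) →L[ℝ] ℝ}
    (hw : HasWeakFDerivOn ⟨{c}ᶜ, isOpen_compl_singleton⟩ volume w Gw) {r₀ : ℝ} (hr₀ : 0 < r₀)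
    (hw2 : IntegrableOn (fun y => w y ^ 2) (ball c r₀))
    (hG2 : IntegrableOn (fun y => ∑ k : Fin 2, (Gw y (EuclideanSpace.single k 1)) ^ 2) (ball c r₀)) :
    HasWeakFDerivOn ⟨univ, isOpen_univ⟩ volume w Gw := by
  -- measurability and local integrability on the whole plane
  have hwm : AEStronglyMeasurable w volume := by
    simpa [restrict_compl_singleton] using hw.locallyIntegrableOn.aestronglyMeasurable
  have hGm : AEStronglyMeasurable Gw volume := by
    simpa [restrict_compl_singleton] using hw.locallyIntegrableOn_deriv.aestronglyMeasurable
  haveI : IsFiniteMeasure (volume.restrict (ball c r₀)) := isFiniteMeasure_restrict.2 measure_ball_lt_top.ne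
  have hwB : IntegrableOn w (ball c r₀) := ((memLp_two_iff_integrable_sq hwm.restrict).2 hw2).integrable one_le_two
  obtain ⟨hGB, hGvB⟩ := integrableOn_of_energy hGm hG2
  have hloc : ∀ {G : Type} [NormedAddCommGroup G] {f : EuclideanSpace ℝ (Fin 2) → G},
      LocallyIntegrableOn f ({c}ᶜ : Set (EuclideanSpace ℝ (Fin 2))) volume → IntegrableOn f (ball c r₀) →
      LocallyIntegrable f volume := by
    intro G _ f hf hB x
    by_cases hx : x = c
    · subst hx; exact ⟨ball x r₀, ball_mem_nhds x hr₀, hB⟩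
    · have h := hf x hx
      rwa [IntegrableAtFilter, isOpen_compl_singleton.nhdsWithin_eq hx] at h
  have hwl : LocallyIntegrable w volume := hloc hw.locallyIntegrableOn hwB
  have hGl : LocallyIntegrable Gw volume := hloc hw.locallyIntegrableOn_deriv hGB
  refine ⟨hwl.locallyIntegrableOn _, hGl.locallyIntegrableOn _, fun φ v hφ => ?_⟩
  simp only [Opens.coe_mk, Measure.restrict_univ, smul_eq_mul]
  -- cut-offs
  obtain ⟨K, hK0, hKε⟩ := exists_cutoff_family c
  have hεn : ∀ n : ℕ, 0 < r₀ / (2 * (n + 1)) := fun n => by positivity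
  choose χ hχs hχ01 hχ1 hχ0 hχd using fun n : ℕ => hKε _ (hεn n)
  -- bounds for `φ`, `∂_v φ`
  obtain ⟨Mφ, hMφ⟩ := hφ.contDiff.continuous.bounded_above_of_compact_support hφ.hasCompactSupport
  have hφ'c : Continuous fun y => fderiv ℝ φ y v :=
    (hφ.contDiff.continuous_fderiv (by simp)).clm_apply continuous_const
  have hφ's : HasCompactSupport fun y => fderiv ℝ φ y v := hφ.hasCompactSupport.fderiv_apply (𝕜 := ℝ) v
  obtain ⟨Mφ', hMφ'⟩ := hφ'c.bounded_above_of_compact_support hφ's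
  -- where the cut-offs vanish: `2 ε_n = r₀/(n+1) ≤ dist y c`
  have hχ0' : ∀ (n : ℕ) y, r₀ / (n + 1) ≤ dist y c → χ n y = 0 := fun n y hy =>
    hχ0 n y (by rw [show 2 * (r₀ / (2 * ((n:ℝ) + 1))) = r₀ / (n + 1) by field_simp]; exact hy)
  have hχd0 : ∀ (n : ℕ) y, r₀ / (n + 1) ≤ dist y c → fderiv ℝ (χ n) y = 0 := by
    intro n y hy
    refine IsLocalMin.fderiv_eq_zero ?_
    filter_upwards with z
    rw [hχ0' n y hy]
    exact (hχ01 n z).1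
  -- the three remainders tend to zero
  have hA : Tendsto (fun n => ∫ y, (fderiv ℝ φ y v * χ n y) * w y) atTop (𝓝 0) := by
    refine tendsto_integral_cutoff_mul (C := Mφ') hr₀ (fun n y => ?_) (fun n y hy => ?_) hwB
    · rw [abs_mul, abs_of_nonneg (hχ01 n y).1]
      exact (mul_le_of_le_one_right (abs_nonneg _) (hχ01 n y).2).trans (by simpa using hMφ' y)
    · rw [hχ0' n y hy, mul_zero]
  have hC : Tendsto (fun n => ∫ y, (φ y * χ n y) * Gw y v) atTop (𝓝 0) := by
    refine tendsto_integral_cutoff_mul (C := Mφ) hr₀ (fun n y => ?_) (fun n y hy => ?_) (hGvB v)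
    · rw [abs_mul, abs_of_nonneg (hχ01 n y).1]
      exact (mul_le_of_le_one_right (abs_nonneg _) (hχ01 n y).2).trans (by simpa using hMφ y)
    · rw [hχ0' n y hy, mul_zero]
  have hB : Tendsto (fun n => ∫ y, (φ y * fderiv ℝ (χ n) y v) * w y) atTop (𝓝 0) := by
    refine tendsto_integral_cutoffDeriv_mul (C := 2 * K * ‖v‖ * Mφ) hr₀ (fun n => ?_) (fun n y => ?_)
      (fun n y hy => ?_) hwm hw2
    · exact hφ.contDiff.continuous.mul (((hχs n).continuous_fderiv (by simp)).clm_apply continuous_const)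
    · rw [abs_mul]
      have h1 : |fderiv ℝ (χ n) y v| ≤ K / (r₀ / (2 * (n + 1))) * ‖v‖ := by
        rw [← Real.norm_eq_abs]
        exact (ContinuousLinearMap.le_opNorm _ _).trans (mul_le_mul_of_nonneg_right (hχd n y) (norm_nonneg _))
      have h2 : |φ y| ≤ Mφ := by simpa using hMφ y
      calc |φ y| * |fderiv ℝ (χ n) y v| ≤ Mφ * (K / (r₀ / (2 * (n + 1))) * ‖v‖) :=
            mul_le_mul h2 h1 (abs_nonneg _) ((abs_nonneg _).trans h2)
        _ = 2 * K * ‖v‖ * Mφ * (n + 1) / r₀ := by field_simp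
    · rw [hχd0 n y hy]; simp
  -- the identity off the pole for `ψ_n = φ (1 - χ_n)`
  have hψ : ∀ n : ℕ, ∫ y, fderiv ℝ (fun y => φ y * (1 - χ n y)) y v * w y =
      -∫ y, (φ y * (1 - χ n y)) * Gw y v := by
    intro n
    have h := hw.integral_fderiv_smul_eq _ v
      (isTestFunctionOn_mul_one_sub hφ.contDiff hφ.hasCompactSupport (hχs n) (hεn n) (hχ1 n))
    simpa only [Opens.coe_mk, restrict_compl_singleton, smul_eq_mul] using h
  have hψ' : ∀ (n : ℕ) y, fderiv ℝ (fun y => φ y * (1 - χ n y)) y v =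
      fderiv ℝ φ y v - (fderiv ℝ φ y v * χ n y + φ y * fderiv ℝ (χ n) y v) := by
    intro n y
    have hφd : DifferentiableAt ℝ φ y := hφ.contDiff.differentiable (by simp) y
    have hχd' : DifferentiableAt ℝ (χ n) y := (hχs n).differentiable (by simp) y
    rw [fderiv_fun_mul hφd (hχd'.const_sub 1), fderiv_const_sub]
    simp only [_root_.add_apply, _root_.smul_apply, smul_eq_mul, _root_.neg_apply]
    ring
  -- integrability of the five products
  have I1 : Integrable fun y => fderiv ℝ φ y v * w y :=
    integrable_smul_of_locallyIntegrableOn (Ω := ⟨univ, isOpen_univ⟩) (hwl.locallyIntegrableOn _) hφ'c hφ's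
      (subset_univ _)
  have I2 : ∀ n, Integrable fun y => (fderiv ℝ φ y v * χ n y) * w y := fun n => by
    have := integrable_smul_of_locallyIntegrableOn (Ω := ⟨univ, isOpen_univ⟩) (hwl.locallyIntegrableOn _)
      (κ := fun y => fderiv ℝ φ y v * χ n y) (hφ'c.mul (hχs n).continuous) (hφ's.mul_right) (subset_univ _)
    simpa only [smul_eq_mul] using this
  have I3 : ∀ n, Integrable fun y => (φ y * fderiv ℝ (χ n) y v) * w y := fun n => by
    have := integrable_smul_of_locallyIntegrableOn (Ω := ⟨univ, isOpen_univ⟩) (hwl.locallyIntegrableOn _)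
      (κ := fun y => φ y * fderiv ℝ (χ n) y v)
      (hφ.contDiff.continuous.mul (((hχs n).continuous_fderiv (by simp)).clm_apply continuous_const))
      (hφ.hasCompactSupport.mul_right) (subset_univ _)
    simpa only [smul_eq_mul] using this
  have I4 : Integrable fun y => φ y * Gw y v := by
    have := integrable_smul_of_locallyIntegrableOn (Ω := ⟨univ, isOpen_univ⟩)
      (((ContinuousLinearMap.apply ℝ ℝ v).locallyIntegrableOn_comp (hGl.locallyIntegrableOn univ)))
      hφ.contDiff.continuous hφ.hasCompactSupport (subset_univ _)
    simpa only [smul_eq_mul, Function.comp_apply, ContinuousLinearMap.apply_apply] using this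
  have I5 : ∀ n, Integrable fun y => (φ y * χ n y) * Gw y v := fun n => by
    have := integrable_smul_of_locallyIntegrableOn (Ω := ⟨univ, isOpen_univ⟩)
      (((ContinuousLinearMap.apply ℝ ℝ v).locallyIntegrableOn_comp (hGl.locallyIntegrableOn univ)))
      (κ := fun y => φ y * χ n y)
      (hφ.contDiff.continuous.mul (hχs n).continuous) (hφ.hasCompactSupport.mul_right) (subset_univ _)
    simpa only [smul_eq_mul, Function.comp_apply, ContinuousLinearMap.apply_apply] using this
  -- the defect is constant and equals the sum of the three remainders
  have hdef : ∀ n : ℕ, (∫ y, fderiv ℝ φ y v * w y) + ∫ y, φ y * Gw y v =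
      (∫ y, (fderiv ℝ φ y v * χ n y) * w y) + (∫ y, (φ y * fderiv ℝ (χ n) y v) * w y) +
        ∫ y, (φ y * χ n y) * Gw y v := by
    intro n
    have h := hψ n
    simp_rw [hψ'] at h
    have e1 : ∫ y, (fderiv ℝ φ y v - (fderiv ℝ φ y v * χ n y + φ y * fderiv ℝ (χ n) y v)) * w y =
        (∫ y, fderiv ℝ φ y v * w y) - ((∫ y, (fderiv ℝ φ y v * χ n y) * w y) +
          ∫ y, (φ y * fderiv ℝ (χ n) y v) * w y) := by
      have hfun : (fun y => (fderiv ℝ φ y v - (fderiv ℝ φ y v * χ n y + φ y * fderiv ℝ (χ n) y v)) * w y) =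
          fun y => fderiv ℝ φ y v * w y - ((fderiv ℝ φ y v * χ n y) * w y + (φ y * fderiv ℝ (χ n) y v) * w y) := by
        funext y; ring
      have I23 : Integrable fun y => (fderiv ℝ φ y v * χ n y) * w y + (φ y * fderiv ℝ (χ n) y v) * w y :=
        (I2 n).add (I3 n)
      rw [hfun, integral_sub I1 I23, integral_add (I2 n) (I3 n)]
    have e2 : ∫ y, (φ y * (1 - χ n y)) * Gw y v = (∫ y, φ y * Gw y v) - ∫ y, (φ y * χ n y) * Gw y v := by
      have hfun : (fun y => (φ y * (1 - χ n y)) * Gw y v) = fun y => φ y * Gw y v - (φ y * χ n y) * Gw y v := by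
        funext y; ring
      rw [hfun, integral_sub I4 (I5 n)]
    rw [e1, e2] at h
    linarith
  have hlim : Tendsto (fun n : ℕ => (∫ y, (fderiv ℝ φ y v * χ n y) * w y) +
      (∫ y, (φ y * fderiv ℝ (χ n) y v) * w y) + ∫ y, (φ y * χ n y) * Gw y v) atTop (𝓝 0) := by
    simpa using (hA.add hB).add hC
  have hS : Tendsto (fun n : ℕ => (∫ y, (fderiv ℝ φ y v * χ n y) * w y) +
      (∫ y, (φ y * fderiv ℝ (χ n) y v) * w y) + ∫ y, (φ y * χ n y) * Gw y v) atTop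
      (𝓝 ((∫ y, fderiv ℝ φ y v * w y) + ∫ y, φ y * Gw y v)) :=
    (tendsto_const_nhds (x := (∫ y, fderiv ℝ φ y v * w y) + ∫ y, φ y * Gw y v)).congr hdef
  have hconst := tendsto_nhds_unique hS hlim
  linarith

/-! ## §2 The Wente ∕ H-system row extends across the pole -/

/-- **Removable pole for the Wente row**: if `−∫ Σ_k ∂_kη · Gu e_k = 2 ∫ η · J` for all test
functions `η` on `{c}ᶜ`, where `Gu` is locally integrable off `c` with `Σ_k (Gu e_k)² ∈ L¹(B(c, r₀))`
and `J` is locally integrable, then the row holds for every compactly supported smooth `η`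
(cut-off splitting; the remainders vanish by the two lemmas of part 4). [cite: BrezisCoron1985, Appendix p. 48 (inversion step)] -/
theorem wenteRow_univ_of_compl_singleton {c : EuclideanSpace ℝ (Fin 2)}
    {Gu : EuclideanSpace ℝ (Fin 2) → EuclideanSpace ℝ (Fin 2) →L[ℝ] ℝ} {J : EuclideanSpace ℝ (Fin 2) → ℝ}
    (hGm : AEStronglyMeasurable Gu volume)
    (hGloc : LocallyIntegrableOn Gu ({c}ᶜ : Set (EuclideanSpace ℝ (Fin 2))) volume)
    {r₀ : ℝ} (hr₀ : 0 < r₀)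
    (hG2 : IntegrableOn (fun y => ∑ k : Fin 2, (Gu y (EuclideanSpace.single k 1)) ^ 2) (ball c r₀))
    (hJ : LocallyIntegrable J volume)
    (h : ∀ η : EuclideanSpace ℝ (Fin 2) → ℝ, IsTestFunctionOn ⟨{c}ᶜ, isOpen_compl_singleton⟩ η →
      -(∫ x, ∑ k : Fin 2, fderiv ℝ η x (EuclideanSpace.single k 1) * Gu x (EuclideanSpace.single k 1)) =
        2 * ∫ x, η x * J x)
    (η : EuclideanSpace ℝ (Fin 2) → ℝ) (hη : ContDiff ℝ ∞ η) (hηs : HasCompactSupport η) :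
    -(∫ x, ∑ k : Fin 2, fderiv ℝ η x (EuclideanSpace.single k 1) * Gu x (EuclideanSpace.single k 1)) =
      2 * ∫ x, η x * J x := by
  haveI : IsFiniteMeasure (volume.restrict (ball c r₀)) := isFiniteMeasure_restrict.2 measure_ball_lt_top.ne
  obtain ⟨hGB, hGvB⟩ := integrableOn_of_energy hGm hG2
  -- `Gu` and its components are locally integrable on the whole plane
  have hGl : LocallyIntegrable Gu volume := by
    intro x
    by_cases hx : x = c
    · subst hx; exact ⟨ball x r₀, ball_mem_nhds x hr₀, hGB⟩
    · have h := hGloc x hx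
      rwa [IntegrableAtFilter, isOpen_compl_singleton.nhdsWithin_eq hx] at h
  have hGkl : ∀ k : Fin 2, LocallyIntegrable (fun y => Gu y (EuclideanSpace.single k 1)) volume := by
    intro k
    have h := (ContinuousLinearMap.apply ℝ ℝ (EuclideanSpace.single k (1 : ℝ))).locallyIntegrableOn_comp
      (hGl.locallyIntegrableOn univ)
    rw [locallyIntegrableOn_univ] at h
    simpa [Function.comp_def] using h
  have hJB : IntegrableOn J (ball c r₀) :=
    (hJ.integrableOn_isCompact (isCompact_closedBall c r₀)).mono_set ball_subset_closedBall
  -- cut-offs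
  obtain ⟨K, hK0, hKε⟩ := exists_cutoff_family c
  have hεn : ∀ n : ℕ, 0 < r₀ / (2 * (n + 1)) := fun n => by positivity
  choose χ hχs hχ01 hχ1 hχ0 hχd using fun n : ℕ => hKε _ (hεn n)
  obtain ⟨Mη, hMη⟩ := hη.continuous.bounded_above_of_compact_support hηs
  have hη'c : ∀ k : Fin 2, Continuous fun y => fderiv ℝ η y (EuclideanSpace.single k 1) := fun k =>
    (hη.continuous_fderiv (by simp)).clm_apply continuous_const
  have hη's : ∀ k : Fin 2, HasCompactSupport fun y => fderiv ℝ η y (EuclideanSpace.single k 1) := fun k =>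
    hηs.fderiv_apply (𝕜 := ℝ) _
  have hχ0' : ∀ (n : ℕ) y, r₀ / (n + 1) ≤ dist y c → χ n y = 0 := fun n y hy =>
    hχ0 n y (by rw [show 2 * (r₀ / (2 * ((n:ℝ) + 1))) = r₀ / (n + 1) by field_simp]; exact hy)
  have hχd0 : ∀ (n : ℕ) y, r₀ / (n + 1) ≤ dist y c → fderiv ℝ (χ n) y = 0 := by
    intro n y hy
    refine IsLocalMin.fderiv_eq_zero ?_
    filter_upwards with z
    rw [hχ0' n y hy]
    exact (hχ01 n z).1
  -- the remainders tend to zero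
  have hA : ∀ k : Fin 2, Tendsto (fun n => ∫ y, (fderiv ℝ η y (EuclideanSpace.single k 1) * χ n y) *
      Gu y (EuclideanSpace.single k 1)) atTop (𝓝 0) := by
    intro k
    obtain ⟨M', hM'⟩ := (hη'c k).bounded_above_of_compact_support (hη's k)
    refine tendsto_integral_cutoff_mul (C := M') hr₀ (fun n y => ?_) (fun n y hy => ?_) (hGvB _)
    · rw [abs_mul, abs_of_nonneg (hχ01 n y).1]
      exact (mul_le_of_le_one_right (abs_nonneg _) (hχ01 n y).2).trans (by simpa using hM' y)
    · rw [hχ0' n y hy, mul_zero]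
  have hB : ∀ k : Fin 2, Tendsto (fun n => ∫ y, (η y * fderiv ℝ (χ n) y (EuclideanSpace.single k 1)) *
      Gu y (EuclideanSpace.single k 1)) atTop (𝓝 0) := by
    intro k
    have hkm : AEStronglyMeasurable (fun y => Gu y (EuclideanSpace.single k 1)) volume :=
      (ContinuousLinearMap.apply ℝ ℝ (EuclideanSpace.single k (1 : ℝ))).continuous.comp_aestronglyMeasurable hGm
    have hk2 : IntegrableOn (fun y => (Gu y (EuclideanSpace.single k 1)) ^ 2) (ball c r₀) := by
      refine hG2.mono' ((continuous_pow 2).comp_aestronglyMeasurable hkm.restrict) (Eventually.of_forall fun y => ?_)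
      rw [Real.norm_eq_abs, abs_of_nonneg (sq_nonneg _)]
      exact Finset.single_le_sum (f := fun k => (Gu y (EuclideanSpace.single k 1)) ^ 2)
        (fun i _ => sq_nonneg _) (Finset.mem_univ k)
    refine tendsto_integral_cutoffDeriv_mul (C := 2 * K * Mη) hr₀ (fun n => ?_) (fun n y => ?_)
      (fun n y hy => ?_) hkm hk2
    · exact hη.continuous.mul (((hχs n).continuous_fderiv (by simp)).clm_apply continuous_const)
    · rw [abs_mul]
      have h1 : |fderiv ℝ (χ n) y (EuclideanSpace.single k 1)| ≤ K / (r₀ / (2 * (n + 1))) := by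
        rw [← Real.norm_eq_abs]
        refine (ContinuousLinearMap.le_opNorm _ _).trans ?_
        rw [PiLp.norm_single, norm_one, mul_one]
        exact hχd n y
      have h2 : |η y| ≤ Mη := by simpa using hMη y
      calc |η y| * |fderiv ℝ (χ n) y (EuclideanSpace.single k 1)| ≤ Mη * (K / (r₀ / (2 * (n + 1)))) :=
            mul_le_mul h2 h1 (abs_nonneg _) ((abs_nonneg _).trans h2)
        _ = 2 * K * Mη * (n + 1) / r₀ := by field_simp
    · rw [hχd0 n y hy]; simp
  have hC : Tendsto (fun n => ∫ y, (η y * χ n y) * J y) atTop (𝓝 0) := by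
    refine tendsto_integral_cutoff_mul (C := Mη) hr₀ (fun n y => ?_) (fun n y hy => ?_) hJB
    · rw [abs_mul, abs_of_nonneg (hχ01 n y).1]
      exact (mul_le_of_le_one_right (abs_nonneg _) (hχ01 n y).2).trans (by simpa using hMη y)
    · rw [hχ0' n y hy, mul_zero]
  -- integrability of the products
  have I1 : ∀ k : Fin 2, Integrable fun y => fderiv ℝ η y (EuclideanSpace.single k 1) * Gu y (EuclideanSpace.single k 1) :=
    fun k => integrable_smul_of_locallyIntegrableOn (Ω := ⟨univ, isOpen_univ⟩) ((hGkl k).locallyIntegrableOn _)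
      (hη'c k) (hη's k) (subset_univ _)
  have I2 : ∀ (k : Fin 2) n, Integrable fun y => (fderiv ℝ η y (EuclideanSpace.single k 1) * χ n y) *
      Gu y (EuclideanSpace.single k 1) := fun k n =>
    integrable_smul_of_locallyIntegrableOn (Ω := ⟨univ, isOpen_univ⟩) ((hGkl k).locallyIntegrableOn _)
      (κ := fun y => fderiv ℝ η y (EuclideanSpace.single k 1) * χ n y) ((hη'c k).mul (hχs n).continuous)
      ((hη's k).mul_right) (subset_univ _)
  have I3 : ∀ (k : Fin 2) n, Integrable fun y => (η y * fderiv ℝ (χ n) y (EuclideanSpace.single k 1)) *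
      Gu y (EuclideanSpace.single k 1) := fun k n =>
    integrable_smul_of_locallyIntegrableOn (Ω := ⟨univ, isOpen_univ⟩) ((hGkl k).locallyIntegrableOn _)
      (κ := fun y => η y * fderiv ℝ (χ n) y (EuclideanSpace.single k 1))
      (hη.continuous.mul (((hχs n).continuous_fderiv (by simp)).clm_apply continuous_const))
      (hηs.mul_right) (subset_univ _)
  have I4 : Integrable fun y => η y * J y :=
    integrable_smul_of_locallyIntegrableOn (Ω := ⟨univ, isOpen_univ⟩) (hJ.locallyIntegrableOn _) hη.continuous
      hηs (subset_univ _)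
  have I5 : ∀ n, Integrable fun y => (η y * χ n y) * J y := fun n =>
    integrable_smul_of_locallyIntegrableOn (Ω := ⟨univ, isOpen_univ⟩) (hJ.locallyIntegrableOn _)
      (κ := fun y => η y * χ n y) (hη.continuous.mul (hχs n).continuous) (hηs.mul_right) (subset_univ _)
  -- the row for `ψ_n = η (1 - χ_n)`, expanded
  have hψ' : ∀ (n : ℕ) (k : Fin 2) y, fderiv ℝ (fun y => η y * (1 - χ n y)) y (EuclideanSpace.single k 1) =
      fderiv ℝ η y (EuclideanSpace.single k 1) -
        (fderiv ℝ η y (EuclideanSpace.single k 1) * χ n y + η y * fderiv ℝ (χ n) y (EuclideanSpace.single k 1)) := by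
    intro n k y
    have hηd : DifferentiableAt ℝ η y := hη.differentiable (by simp) y
    have hχd' : DifferentiableAt ℝ (χ n) y := (hχs n).differentiable (by simp) y
    rw [fderiv_fun_mul hηd (hχd'.const_sub 1), fderiv_const_sub]
    simp only [_root_.add_apply, _root_.smul_apply, smul_eq_mul, _root_.neg_apply]
    ring
  have hdef : ∀ n : ℕ,
      -(∑ k : Fin 2, ∫ y, fderiv ℝ η y (EuclideanSpace.single k 1) * Gu y (EuclideanSpace.single k 1)) -
          2 * ∫ y, η y * J y =
        -(∑ k : Fin 2, ∫ y, (fderiv ℝ η y (EuclideanSpace.single k 1) * χ n y) * Gu y (EuclideanSpace.single k 1)) -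
          (∑ k : Fin 2, ∫ y, (η y * fderiv ℝ (χ n) y (EuclideanSpace.single k 1)) * Gu y (EuclideanSpace.single k 1)) -
          2 * ∫ y, (η y * χ n y) * J y := by
    intro n
    have hrow := h _ (isTestFunctionOn_mul_one_sub hη hηs (hχs n) (hεn n) (hχ1 n))
    simp_rw [hψ'] at hrow
    have I123 : ∀ k : Fin 2, Integrable fun y => (fderiv ℝ η y (EuclideanSpace.single k 1) -
        (fderiv ℝ η y (EuclideanSpace.single k 1) * χ n y + η y * fderiv ℝ (χ n) y (EuclideanSpace.single k 1))) *
          Gu y (EuclideanSpace.single k 1) := by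
      intro k
      have h23 : Integrable fun y => (fderiv ℝ η y (EuclideanSpace.single k 1) * χ n y) *
          Gu y (EuclideanSpace.single k 1) + (η y * fderiv ℝ (χ n) y (EuclideanSpace.single k 1)) *
            Gu y (EuclideanSpace.single k 1) := (I2 k n).add (I3 k n)
      have := (I1 k).sub h23
      refine this.congr (Eventually.of_forall fun y => ?_)
      simp only [Pi.sub_apply]; ring
    rw [integral_finsetSum _ fun k _ => I123 k] at hrow
    have e1 : ∀ k : Fin 2, ∫ y, (fderiv ℝ η y (EuclideanSpace.single k 1) -
        (fderiv ℝ η y (EuclideanSpace.single k 1) * χ n y + η y * fderiv ℝ (χ n) y (EuclideanSpace.single k 1))) *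
          Gu y (EuclideanSpace.single k 1) =
        (∫ y, fderiv ℝ η y (EuclideanSpace.single k 1) * Gu y (EuclideanSpace.single k 1)) -
          ((∫ y, (fderiv ℝ η y (EuclideanSpace.single k 1) * χ n y) * Gu y (EuclideanSpace.single k 1)) +
            ∫ y, (η y * fderiv ℝ (χ n) y (EuclideanSpace.single k 1)) * Gu y (EuclideanSpace.single k 1)) := by
      intro k
      have hfun : (fun y => (fderiv ℝ η y (EuclideanSpace.single k 1) -
          (fderiv ℝ η y (EuclideanSpace.single k 1) * χ n y + η y * fderiv ℝ (χ n) y (EuclideanSpace.single k 1))) *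
            Gu y (EuclideanSpace.single k 1)) =
          fun y => fderiv ℝ η y (EuclideanSpace.single k 1) * Gu y (EuclideanSpace.single k 1) -
            ((fderiv ℝ η y (EuclideanSpace.single k 1) * χ n y) * Gu y (EuclideanSpace.single k 1) +
              (η y * fderiv ℝ (χ n) y (EuclideanSpace.single k 1)) * Gu y (EuclideanSpace.single k 1)) := by
        funext y; ring
      have h23 : Integrable fun y => (fderiv ℝ η y (EuclideanSpace.single k 1) * χ n y) *
          Gu y (EuclideanSpace.single k 1) + (η y * fderiv ℝ (χ n) y (EuclideanSpace.single k 1)) *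
            Gu y (EuclideanSpace.single k 1) := (I2 k n).add (I3 k n)
      rw [hfun, integral_sub (I1 k) h23, integral_add (I2 k n) (I3 k n)]
    have e2 : ∫ y, (η y * (1 - χ n y)) * J y = (∫ y, η y * J y) - ∫ y, (η y * χ n y) * J y := by
      have hfun : (fun y => (η y * (1 - χ n y)) * J y) = fun y => η y * J y - (η y * χ n y) * J y := by
        funext y; ring
      rw [hfun, integral_sub I4 (I5 n)]
    simp_rw [e1] at hrow
    rw [e2, Finset.sum_sub_distrib, Finset.sum_add_distrib] at hrow
    linarith
  have hlim : Tendsto (fun n : ℕ =>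
      -(∑ k : Fin 2, ∫ y, (fderiv ℝ η y (EuclideanSpace.single k 1) * χ n y) * Gu y (EuclideanSpace.single k 1)) -
        (∑ k : Fin 2, ∫ y, (η y * fderiv ℝ (χ n) y (EuclideanSpace.single k 1)) * Gu y (EuclideanSpace.single k 1)) -
        2 * ∫ y, (η y * χ n y) * J y) atTop (𝓝 0) := by
    have h1 := tendsto_finsetSum (Finset.univ : Finset (Fin 2)) fun k _ => hA k
    have h2 := tendsto_finsetSum (Finset.univ : Finset (Fin 2)) fun k _ => hB k
    simpa using (h1.neg.sub h2).sub (hC.const_mul 2)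
  have hS : Tendsto (fun n : ℕ =>
      -(∑ k : Fin 2, ∫ y, (fderiv ℝ η y (EuclideanSpace.single k 1) * χ n y) * Gu y (EuclideanSpace.single k 1)) -
        (∑ k : Fin 2, ∫ y, (η y * fderiv ℝ (χ n) y (EuclideanSpace.single k 1)) * Gu y (EuclideanSpace.single k 1)) -
        2 * ∫ y, (η y * χ n y) * J y) atTop
      (𝓝 (-(∑ k : Fin 2, ∫ y, fderiv ℝ η y (EuclideanSpace.single k 1) * Gu y (EuclideanSpace.single k 1)) -
          2 * ∫ y, η y * J y)) :=
    tendsto_const_nhds.congr hdef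
  have hconst := tendsto_nhds_unique hS hlim
  rw [integral_finsetSum _ fun k _ => I1 k]
  linarith

end Summit.QuantumFields.YangMills.Theorems.PoincareLipschitzSobolevInversion

end
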